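import Summits.QuantumFields.YangMills.Statement
import HarnessLib

/-!
# SoloBlind: the infrared frontier of `YangMills`, typed

The open content of `YangMills` that no known technology reaches (soloist obstruction file,
§3 "IR-1") is a property of Wilson's LATTICE theory alone: at WEAK bare coupling (large `β`),
exponential clustering in Euclidean time of gauge-invariant local observables, UNIFORMLY IN THE
SIZE OF THE TORUS ("a massive infinite-volume phase"). This file types that property as
standalone predicates and proves the two bookkeeping directions around it:

* `ClustersUniformlyAt r β A B` — torus-uniform exponential time-clustering of the pair `(A, B)`
  at one coupling `β`, at some lattice rate `m > 0`;
* `WeakCouplingClustering r` — the same for every pair, eventually along SOME sequence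
  `β_k → ∞` (thresholds may depend on the pair: this is exactly what the summit yields);
* `GappedAtArbitrarilyWeakCoupling r` — for arbitrarily large `β`, ALL pairs cluster
  torus-uniformly at that `β` (the form one would actually try to prove at fixed `β`; it implies
  the previous one);
* NECESSITY: `YangMills` implies `WeakCouplingClustering r` for some faithful `r`, for every
  compact simple `G` (`weakCouplingClustering_of_yangMills`) — so any proof of the summit proves,
  in particular, this purely lattice-side infrared statement, for which no method is known in
  `d = 4` (the strong-coupling cluster expansion gives it only for `β` below a finite radius);
* SUFFICIENCY BOOKKEEPING: `HasLatticeMassGap r sch Δ` is EQUIVALENT to torus-uniform clustering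
  along the scheme at SOME lattice rates `m_k` with volume thresholds `S₀(k)` (constant uniform in
  `k`), plus the RATE PINNING `Δ · a_k ≤ m_k` (the lattice gap in lattice units may vanish no
  faster than the spacing: the "single dynamical scale" clause) and `S₀(k) ≤ L_k`, eventually
  (`hasLatticeMassGap_iff_exists_rates`).

The predicates make sense for every compact `G`. For `G = U(1)` in `d = 4` they are expected to
FAIL at large `β` — the non-confining, massless "Coulomb" phase (Guth, Phys. Rev. D 21 (1980)
2291, doi:10.1103/physrevd.21.2291; Fröhlich–Spencer, Commun. Math. Phys. 83 (1982) 411,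
doi:10.1007/bf01213610) — while in `d = 3` the `U(1)` theory is massive and confining for all
`β` (Göpfert–Mack, Commun. Math. Phys. 82 (1982) 545, doi:10.1007/bf01961240): a proof for
non-abelian `G` in `d = 4` must use a property that distinguishes it from `U(1)` — none of the
hypotheses of the volume-uniform criteria available in print (Dobrushin uniqueness, Bakry–Émery
at `8N(d−1)|β| < N/2`, cluster expansions) does.
No new mathematics is claimed here: the theorems are elementary; the point is the typing.
References: Jaffe–Witten, *Quantum Yang–Mills theory* (Clay 2000) §5; Osterwalder–Seiler, Ann.
Phys. 110 (1978) 440, §§2–3; Seiler, LNP 159 (1982) Ch. 2.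
-/

open MeasureTheory Filter Topology
open Literature.MathematicalPhysics.QuantumFieldTheory Literature.MathematicalPhysics.QuantumLattice

noncomputable section

namespace Summit.QuantumFields.YangMills.Theorems.SoloBlind

variable {G : Type} [Group G] [TopologicalSpace G] [IsTopologicalGroup G] [CompactSpace G]
  [MeasurableSpace G] [BorelSpace G]

/-! ### IR-1 as standalone predicates on Wilson's lattice theory -/

/-- **Torus-uniform exponential time-clustering of the pair `(A, B)` at bare coupling `β`**: for
some `C`, some lattice rate `m > 0` and some threshold `S₀`, on EVERY periodic torus of side
`2S+1 ≥ 2S₀+1` and for all time separations `n ≤ S`,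
`|⟨A · τ_{n e₀} B⟩_{β,S} − ⟨A⟩_{β,S}⟨B⟩_{β,S}| ≤ C e^{−m n}`. Uniformity in `S` is the content: on a
single torus every truncated correlation of bounded observables is trivially bounded.
[cite: OsterwalderSeiler1978, §§2–3] [cite: JaffeWitten2000, §5] -/
def ClustersUniformlyAt (r : LatticeRep G) (β : ℝ) (A B : YMSpecies G) : Prop :=
  ∃ C m : ℝ, 0 < m ∧ ∃ S₀ : ℕ, ∀ S : ℕ, S₀ ≤ S → ∀ n : ℕ, n ≤ S →
    |latticeConnectedCorr r.ρ β (2 * S + 1) A.F B.F n| ≤ C * Real.exp (-(m * n))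

/-- **IR-1 along a weak-coupling sequence**: there is a sequence of inverse bare couplings
`β_k → +∞` along which every pair of gauge-invariant local observables EVENTUALLY (threshold
depending on the pair) clusters exponentially in time, uniformly in the torus. This is the exact
lattice-side infrared consequence of `YangMills` (`weakCouplingClustering_of_yangMills`).
[cite: JaffeWitten2000, §5] -/
def WeakCouplingClustering (r : LatticeRep G) : Prop :=
  ∃ β : ℕ → ℝ, Tendsto β atTop atTop ∧
    ∀ A B : YMSpecies G, ∀ᶠ k in atTop, ClustersUniformlyAt r (β k) A B

/-- **A massive infinite-volume phase at arbitrarily weak coupling**: for every `β₁` there is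
`β ≥ β₁` at which ALL pairs of gauge-invariant local observables cluster torus-uniformly. (The
form in which IR-1 would be attacked at fixed `β`; the observable-uniform choice of `β` makes it
formally stronger than `WeakCouplingClustering`.) [cite: JaffeWitten2000, §5] -/
def GappedAtArbitrarilyWeakCoupling (r : LatticeRep G) : Prop :=
  ∀ β₁ : ℝ, ∃ β : ℝ, β₁ ≤ β ∧ ∀ A B : YMSpecies G, ClustersUniformlyAt r β A B

/-- The observable-uniform form implies the sequential form (choose `β_k ≥ k`). [folklore] -/
theorem weakCouplingClustering_of_gappedAtArbitrarilyWeakCoupling (r : LatticeRep G)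
    (h : GappedAtArbitrarilyWeakCoupling r) : WeakCouplingClustering r := by
  choose β hβ hcl using fun k : ℕ => h k
  refine ⟨β, ?_, fun A B => Eventually.of_forall fun k => hcl k A B⟩
  exact tendsto_atTop_mono hβ tendsto_natCast_atTop_atTop

/-! ### Necessity: the summit implies IR-1 along its own scheme -/

/-- Along a scheme with a uniform lattice mass gap `Δ > 0`, every pair of observables eventually
clusters torus-uniformly at the scheme's couplings, at lattice rate `Δ · a_k`. [folklore] -/
theorem eventually_clustersUniformlyAt_of_hasLatticeMassGap (r : LatticeRep G)
    (sch : SpeciesScheme (YMSpecies G)) {Δ : ℝ} (hΔ : 0 < Δ) (h : HasLatticeMassGap r sch Δ)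
    (A B : YMSpecies G) : ∀ᶠ k in atTop, ClustersUniformlyAt r (sch.β k) A B := by
  obtain ⟨C, hC⟩ := h A B
  filter_upwards [hC] with k hk
  refine ⟨C, Δ * sch.a k, mul_pos hΔ (sch.a_pos k), sch.L k, fun S hS n hn => ?_⟩
  simpa [mul_assoc] using hk S hS n hn

/-- A weak-coupling scheme with a uniform lattice mass gap witnesses `WeakCouplingClustering`.
[folklore] -/
theorem weakCouplingClustering_of_hasLatticeMassGap (r : LatticeRep G)
    (sch : SpeciesScheme (YMSpecies G)) (hw : sch.HasWeakCouplingLimit) {Δ : ℝ} (hΔ : 0 < Δ)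
    (h : HasLatticeMassGap r sch Δ) : WeakCouplingClustering r :=
  ⟨sch.β, hw, fun A B => eventually_clustersUniformlyAt_of_hasLatticeMassGap r sch hΔ h A B⟩

/-- **Necessity.** `YangMills` implies, for every compact simple `G`, IR-1 along a weak-coupling
sequence in some faithful lattice representation: a purely lattice-side infrared statement that
every proof of the summit must establish. [folklore] -/
theorem weakCouplingClustering_of_yangMills (hYM : YangMills) (G : Type) [Group G]
    [TopologicalSpace G] [IsTopologicalGroup G] [CompactSpace G] (hG : IsCompactSimpleLieGroup G) :
    letI : MeasurableSpace G := borel G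
    haveI : BorelSpace G := ⟨rfl⟩
    ∃ r : LatticeRep G, WeakCouplingClustering r := by
  letI : MeasurableSpace G := borel G
  haveI : BorelSpace G := ⟨rfl⟩
  obtain ⟨r, sch, T, hw, -, -, -, Δ, hΔ, -, hgap⟩ := hYM G hG
  exact ⟨r, weakCouplingClustering_of_hasLatticeMassGap r sch hw hΔ hgap⟩

/-! ### Sufficiency bookkeeping: `HasLatticeMassGap` = IR-1 along the scheme + rate pinning -/

/-- **Sufficiency bookkeeping.** Torus-uniform clustering along the scheme at lattice rates `m_k`
with volume thresholds `S₀(k)` and a `k`-uniform constant, the RATE PINNING `Δ · a_k ≤ m_k`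
eventually (the lattice gap in physical units, `m_k / a_k`, stays `≥ Δ`), and thresholds
eventually below the scheme's volumes give `HasLatticeMassGap r sch Δ`. [folklore] -/
theorem hasLatticeMassGap_of_rates (r : LatticeRep G) (sch : SpeciesScheme (YMSpecies G))
    {Δ : ℝ} {m : ℕ → ℝ} {S₀ : ℕ → ℕ}
    (h : ∀ A B : YMSpecies G, ∃ C : ℝ, ∀ᶠ k in atTop, ∀ S : ℕ, S₀ k ≤ S → ∀ n : ℕ, n ≤ S →
      |latticeConnectedCorr r.ρ (sch.β k) (2 * S + 1) A.F B.F n| ≤ C * Real.exp (-(m k * n)))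
    (hrate : ∀ᶠ k in atTop, Δ * sch.a k ≤ m k) (hvol : ∀ᶠ k in atTop, S₀ k ≤ sch.L k) :
    HasLatticeMassGap r sch Δ := by
  intro A B
  obtain ⟨C, hC⟩ := h A B
  refine ⟨max C 0, ?_⟩
  filter_upwards [hC, hrate, hvol] with k hk hr hv S hS n hn
  have hmn : Δ * (sch.a k * n) ≤ m k * n := by
    rw [← mul_assoc]
    exact mul_le_mul_of_nonneg_right hr n.cast_nonneg
  calc |latticeConnectedCorr r.ρ (sch.β k) (2 * S + 1) A.F B.F n|
      ≤ C * Real.exp (-(m k * n)) := hk S (hv.trans hS) n hn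
    _ ≤ max C 0 * Real.exp (-(m k * n)) :=
        mul_le_mul_of_nonneg_right (le_max_left _ _) (Real.exp_nonneg _)
    _ ≤ max C 0 * Real.exp (-(Δ * (sch.a k * n))) :=
        mul_le_mul_of_nonneg_left (Real.exp_le_exp.2 (by linarith)) (le_max_right _ _)

/-- **`HasLatticeMassGap` decomposed**: a uniform lattice gap `Δ` along the scheme is EXACTLY
torus-uniform clustering at some lattice rates `m_k` and thresholds `S₀(k)` with a `k`-uniform
constant (IR-1 along the scheme), together with the rate pinning `Δ · a_k ≤ m_k` and
`S₀(k) ≤ L_k`, eventually. (`→`: take `m_k = Δ · a_k`, `S₀ = L`.) [folklore] -/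
theorem hasLatticeMassGap_iff_exists_rates (r : LatticeRep G) (sch : SpeciesScheme (YMSpecies G))
    (Δ : ℝ) :
    HasLatticeMassGap r sch Δ ↔ ∃ (m : ℕ → ℝ) (S₀ : ℕ → ℕ),
      (∀ A B : YMSpecies G, ∃ C : ℝ, ∀ᶠ k in atTop, ∀ S : ℕ, S₀ k ≤ S → ∀ n : ℕ, n ≤ S →
        |latticeConnectedCorr r.ρ (sch.β k) (2 * S + 1) A.F B.F n| ≤ C * Real.exp (-(m k * n))) ∧
      (∀ᶠ k in atTop, Δ * sch.a k ≤ m k) ∧ ∀ᶠ k in atTop, S₀ k ≤ sch.L k := by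
  refine ⟨fun h => ⟨fun k => Δ * sch.a k, sch.L, fun A B => ?_,
    Eventually.of_forall fun _ => le_rfl, Eventually.of_forall fun _ => le_rfl⟩,
    fun ⟨_, _, h, hrate, hvol⟩ => hasLatticeMassGap_of_rates r sch h hrate hvol⟩
  obtain ⟨C, hC⟩ := h A B
  refine ⟨C, ?_⟩
  filter_upwards [hC] with k hk S hS n hn
  simpa [mul_assoc] using hk S hS n hn

end Summit.QuantumFields.YangMills.Theorems.SoloBlind

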